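import Summits.BirchSwinnertonDyer.BirchSwinnertonDyer.Theorems.ErratumRoadFiveIMCDivRoadFFFittingCutFeed
import Summits.BirchSwinnertonDyer.BirchSwinnertonDyer.Theorems.ErratumRoadFiveIMCDivAtomsB
import HarnessLib

/-!
# Route `ErratumRoadFive` (rung K2, `p ≥ 5`), crux `IMCDivAtErratumDataAll` (item stmt-BirchSwinnertonDyer-19270) →
# its ORIENTATION-REPAIRED re-filing `IMCDivAtErratumDataAllR`: the coefficient-free ROAD-FF INPUT CUT over the B-atom
# — TWO-SLOT datum shapes (frame prime ≠ X-slot prime), the glue to `P2.IMCDivIntCoreFrameAtErratumDataB`, the feeders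

Cell `bsd-stepL` (run/shared/lean/pub/bsd-stepL/), seat `bsd-stepL-imc-p1` (prover g9, 2026-08-27); `--supports
stmt-BirchSwinnertonDyer-19270 --as helper`; Theses-free (imports only this seat's g8 cut files and imc24b g4's
`ErratumRoadFiveIMCDivAtomsB`). This is the B-side sequel of `ErratumRoadFiveIMCDivRoadFFFittingCutDefs` (p489674) and
`…FittingCutFeed` (p490889) that plan g30 RULING 2 needs to re-register «the same two-stub v4 of imc-p1 #31» on the
repaired item once the typer's choice terms `Σ(·)`, `P_Σ(·)` exist (they do: defn-ty1 g2, `Literature/…/SigmaEulerData.lean`,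
`Σ := ↑(W.sigmaPlacesFinset p K)`, `P_Σ := W.sigmaEulerElement p K κ`).

## CORRECTION to ORIENT-AUDIT-19270 Q4 (a), last sentence («the Road-FF wrappers re-thread verbatim with `𝔭 := 𝔭bar`»)

They do NOT, and this file is the repair. The datum-level Road-FF shapes landed so far —
`P2.OneSidedCongruenceData{,Torsion,Le}At W p κ 𝔭 γ ι f` (imc24c ∕ imc24b) and this seat's
`P2.RoadFF.FittingCongruenceFrameAt W p κ 𝔭 γ ι f S PS` — use ONE prime symbol `𝔭` for TWO rôles: the X-slot of
`XAc (W.baseChange K) p κ 𝔭 S γ` AND the frame's prime in `IsBDPLFunction ι 𝔭 κ γ f Ω_K Ω_p L`, where it is the prime at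
which Castella's interpolation MULTIPLIER `(1 − a_p p⁻¹ φ(𝔭) + ε_p φ(𝔭)²)²` is read (`bdpInterpolationValue p f 𝔭 φ n Ω_K`).
Instantiating `𝔭 := 𝔭bar` therefore produces a frame `IsBDPLFunction ι' 𝔭bar …` — multiplier at `𝔭bar` — which is
NEITHER the B-atom's frame `R1.IsBDPLFunctionInt p ι' (primeOfEmbeddingDatum p ι' w₀.embedding) …` (multiplier at the
datum's prime) NOR supplied by any existence fact (`castella2018_exists_isBDPLFunction` ∕ `thm32_…` carry the compatibility
clause `𝔭 = 𝔭_{ι'}`). The repair is mechanical: SEPARATE the two primes. `P2.RoadFF.SigmaDataAt W p κ 𝔮 γ S PS` has no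
frame and is already slot-generic; the Fitting-level frame gets a two-slot twin
`P2.RoadFF.FittingCongruenceFrameTwoSlotAt W p κ 𝔭 𝔮 γ ι f S PS` (frame at `𝔭`, member limit for `X^Σ` strict at `𝔮`),
equal to the one-slot shape on the diagonal `𝔮 = 𝔭` (`Iff.rfl`). imc24b's recombination
`AcSelmer.XAc.charIdeal_map_toUnr_le_span_of_map_fittingIdeal_le`, imc24c's last mile and the coefficient descent
(p489585) never mention the frame, so every proof below is the g8 proof with `𝔮` in the X-slot.

## Contents (namespace `Summit.BirchSwinnertonDyer.Rank1Residual.X11b`)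

* §1 **`P2.RoadFF.FittingCongruenceFrameTwoSlotAt`** (`@[conjecture]` shape) + diagonal `Iff.rfl`; recombination
  `P2.exists_unrFrame_charIdeal_map_le_of_roadFF_fitting_twoSlot`, last mile
  `P2.exists_intCoreFrame_of_unrFrame_of_charIdeal_map_le_twoSlot`, `P2.exists_intCoreFrame_of_roadFF_fitting_twoSlot`
  (⟹ EXACTLY the B-atom's datum-level conclusion for `𝔭 := 𝔭_{ι'}`, `𝔮 := 𝔭bar`); feeder
  `P2.RoadFF.fittingCongruenceFrameTwoSlotAt_of_members_descent_le_printed` (Hida members over their own `𝒪_m` with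
  (2.5)_m printed on `X^Σ` strict at `𝔮` ⟹ the two-slot shape).
* §2 on the tree: **`P2.RoadFF.SigmaDataAtErratumDataB W p Sg PSg`**, **`P2.RoadFF.FittingCongruenceFrameAtErratumDataB
  W p Sg PSg`** (binders of `P2.IMCDivIntCoreFrameAtErratumDataB` VERBATIM, then the datum shapes at X-slot `𝔭bar`,
  frame at `𝔭_{ι'}`) and the glue **`P2.imcDivIntCoreFrameAtErratumDataB_of_roadFF_fitting`** — the composition of the
  two-stub v4 skeleton on the repaired item: `…R_of := fun W _ _ p _ ↦
  P2.imcDivIntCoreFrameAtErratumDataB_of_roadFF_fitting (s1 W p) (s2 W p)`.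

HONEST FRAMING: three definitions with bodies (open shapes; nothing asserted) and regrouping theorems; no named fact, no
instance, no notation, no `sorry`; nothing is booked; BSD is proved for no pair; the anticyclotomic main conjecture is
asserted nowhere. What each stub still needs is unchanged from evidence #31 (S_Σ: F7 = JSW17 Prop. 3.3.2 — now a tree
fact with defn-ty1's `sigmaData_of_prop332` at ANY slot `v`; S_Fitt: Cas18 Thm. 3.1 frame at `𝔭_{ι'}`, `L^Σ`, per-`m`
Hida members with FW21 Thm. 4.41 on `X^Σ` STRICT AT `𝔭bar`, (c), faithful flatness).

References: [Castella2018Erratum] (b), (c), Lemma 2.1, (2.4)–(2.5), proof of Thm. 1.1 (pp. 2–4); [Castella2018] Thm. 3.1,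
(3.1), (4.1) (arXiv:1704.06608 pp. 9, 11); [FouquetWan2021] Thm. 4.41 (PREPRINT; shape only); [Skinner2016PacificMC] §3.1
(p. 192); [CastellaGrossiLeeSkinner2022] §2 (the `(v, v̄)` slotting); HOME/audit/ORIENT-AUDIT-19270-imc-p1-g8.md Q4;
HOME/imc-p1/ROADFF-CUT-19270-imc-p1-g8.md (evidence #31).
-/

set_option autoImplicit false

noncomputable section

open scoped Classical TensorProduct

open WeierstrassCurve NumberField IsDedekindDomain Field PowerSeries
open Literature.NumberTheory.EllipticCurves Literature.NumberTheory.EllipticCurves.GreenbergSelmer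
  Literature.NumberTheory.EllipticCurves.ModularForms Literature.NumberTheory.EllipticCurves.Rank1Residual
  Literature.NumberTheory.EllipticCurves.Rank1Residual.Typed Literature.NumberTheory.EllipticCurves.Castella2018
  Literature.NumberTheory.EllipticCurves.Module Literature.NumberTheory.GaloisRepresentations
  Literature.NumberTheory.GaloisCohomology Literature.RingTheory.FittingIdeal
open Summit.BirchSwinnertonDyer.Rank1Residual.X11b.AcSelmer Summit.BirchSwinnertonDyer.Rank1Residual.X11b.Halves

namespace Summit.BirchSwinnertonDyer.Rank1Residual.X11b

/-! ### §1 The two-slot Fitting-level congruence frame at a datum -/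

section TwoSlot

variable {K : Type} [Field K] [NumberField K] (W : WeierstrassCurve ℚ) (p : ℕ) [Fact p.Prime]
  (κ : ZpExtension K p) (𝔭 𝔮 : HeightOneSpectrum (𝓞 K)) (γ : Field.absoluteGaloisGroup K)
  [Fact (κ.IsTopGenerator γ)] (ι : PadicAlgCl p ≃+* ℂ) {N : ℕ}
  (f : CuspForm (CongruenceSubgroup.Gamma0 N) 2)
  (S : Set (HeightOneSpectrum (𝓞 K))) (PS : IwasawaAlgebra p)

/-- **ROAD FF, FITTING-LEVEL CONGRUENCE FRAME AT A DATUM, TWO SLOTS (shape; asserts nothing)** — an `R₀`-frame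
`(Ω_K ≠ 0, Ω_p ∈ R₀ˣ, L)` with Castella's interpolation property `IsBDPLFunction ι 𝔭 κ γ f Ω_K Ω_p L` AT THE FRAME PRIME
`𝔭` [Cas18 Thm. 3.1]; a `Σ`-imprimitive `L^Σ ∈ R₀⟦T⟧` with `L·φ(P_Σ) ∣ L^Σ` [Cas18 (3.1)]; and the member limit
`Fitt₀_Λ(X^Σ)·R₀⟦T⟧ ⊆ (L^Σ)` for the Selmer dual `X^Σ = XAc (W.baseChange K) p κ 𝔮 S γ` STRICT AT THE X-SLOT `𝔮`
[erratum (b), Lemma 2.1, (2.5)_m = FW21 Thm. 4.41 at `p ∥ N` (PREPRINT), (c), descended to `R₀⟦T⟧`]. On the diagonal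
`𝔮 = 𝔭` this is `P2.RoadFF.FittingCongruenceFrameAt`; the orientation-repaired crux uses `𝔭 = 𝔭_{ι'}`, `𝔮 = 𝔭bar`.
A predicate; NEVER a theorem in this cell. [claim: Castella2018Erratum, status: under-review]
[cite: Castella2018Erratum, (b), (c), Lemma 2.1, (2.5), proof of Thm. 1.1 (pp. 2–4) (shape only; nothing asserted)]
[cite: Castella2018, Thm. 3.1, (3.1), (4.1) (arXiv:1704.06608 pp. 9, 11) (shape only; nothing asserted)]
[cite: CastellaGrossiLeeSkinner2022, §2 (the `(v, v̄)` slotting; shape only)] -/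
@[conjecture]
def P2.RoadFF.FittingCongruenceFrameTwoSlotAt : Prop :=
  ∃ (ΩK : ℂ) (Ωp : (unrIntegers p)ˣ) (L LS : UnrSeries p),
    ΩK ≠ 0 ∧ IsBDPLFunction ι 𝔭 κ γ f ΩK ((Ωp : unrIntegers p) : ℂ_[p]) L ∧
    L * PowerSeries.map (toUnr p) PS ∣ LS ∧
    (Module.fittingIdeal (IwasawaAlgebra p) (XAc (W.baseChange K) p κ 𝔮 S γ) 0).map
        (PowerSeries.map (toUnr p)) ≤ Ideal.span {LS}

/-- On the diagonal `𝔮 = 𝔭` the two-slot shape IS the one-slot shape of p489674 (`Iff.rfl`). [folklore] -/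
theorem P2.RoadFF.fittingCongruenceFrameTwoSlotAt_self_iff :
    P2.RoadFF.FittingCongruenceFrameTwoSlotAt W p κ 𝔭 𝔭 γ ι f S PS ↔
      P2.RoadFF.FittingCongruenceFrameAt W p κ 𝔭 γ ι f S PS :=
  Iff.rfl

variable {W p κ 𝔭 𝔮 γ ι f S PS}

/-- **RECOMBINATION, two slots: `Σ`-data at the X-slot `𝔮` ∧ the two-slot congruence frame ⟹ an `R₀`-frame AT `𝔭`
with `Ch_Λ(XAc … 𝔮 ∅ γ)·R₀⟦T⟧ ⊆ (L)`** (imc24b's `AcSelmer.XAc.charIdeal_map_toUnr_le_span_of_map_fittingIdeal_le`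
at the slot `𝔮`: torsion bounds, `Σ`-removal, two-prime cancellation in the UFD `R₀⟦T⟧`; the frame rides along).
Unconditional in the two predicates. [cite: Castella2018Erratum, proof of Thm. 1.1 (p. 4), read one-sidedly] -/
theorem P2.exists_unrFrame_charIdeal_map_le_of_roadFF_fitting_twoSlot [W.IsElliptic]
    (hSD : P2.RoadFF.SigmaDataAt W p κ 𝔮 γ S PS)
    (hF : P2.RoadFF.FittingCongruenceFrameTwoSlotAt W p κ 𝔭 𝔮 γ ι f S PS) :
    ∃ (ΩK : ℂ) (Ωp : (unrIntegers p)ˣ) (L : UnrSeries p), ΩK ≠ 0 ∧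
      IsBDPLFunction ι 𝔭 κ γ f ΩK ((Ωp : unrIntegers p) : ℂ_[p]) L ∧
      (XAc.charIdeal (W.baseChange K) p κ 𝔮 ∅ γ).map (PowerSeries.map (toUnr p)) ≤
        Ideal.span {L} := by
  obtain ⟨hS, hT, hPS, hX⟩ := hSD
  obtain ⟨ΩK, Ωp, L, LS, hΩ, hL, hLS, key⟩ := hF
  exact ⟨ΩK, Ωp, L, hΩ, hL,
    AcSelmer.XAc.charIdeal_map_toUnr_le_span_of_map_fittingIdeal_le (W.baseChange K) p κ 𝔮 γ hS hT
      key hPS hX hLS⟩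

/-- **LAST MILE, two slots** (imc24c's `P2.exists_intCoreFrame_of_unrFrame_of_charIdeal_map_le` with the frame at `𝔭`
and the divisibility at `𝔮`): read the `R₀`-frame in `𝓞_{ℂ_p}⟦T⟧` (`R1.isBDPLFunctionInt_map`) and transport the
divisibility along `R₀ ⊆ 𝓞_{ℂ_p}` (`R1.ideal_map_le_span_map_of_le`). Unconditional.
[cite: Castella2018Erratum, (2.4) (p. 4)] [cite: Hsieh2014, p. 7 (the receptacle `Z̄_p⟦Γ⁻⟧ ⊆ 𝓞_{ℂ_p}⟦T⟧`)] -/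
theorem P2.exists_intCoreFrame_of_unrFrame_of_charIdeal_map_le_twoSlot {ΩK : ℂ} {Ωp : (unrIntegers p)ˣ}
    {L : UnrSeries p} (hΩ : ΩK ≠ 0)
    (hL : IsBDPLFunction ι 𝔭 κ γ f ΩK ((Ωp : unrIntegers p) : ℂ_[p]) L)
    (hdiv : (XAc.charIdeal (W.baseChange K) p κ 𝔮 ∅ γ).map (PowerSeries.map (toUnr p)) ≤
      Ideal.span {L}) :
    ∃ (ΩK : ℂ) (Ωp : ℂ_[p]) (Q : PowerSeries 𝓞_ℂ_[p]), ΩK ≠ 0 ∧ ‖Ωp‖ = 1 ∧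
      R1.IsBDPLFunctionInt p ι 𝔭 κ γ f ΩK Ωp Q ∧
      (XAc.charIdeal (W.baseChange K) p κ 𝔮 ∅ γ).map (PowerSeries.map (R1.toCpInt p)) ≤
        Ideal.span {Q} :=
  ⟨ΩK, ((Ωp : unrIntegers p) : ℂ_[p]), PowerSeries.map (R1.unrToCpInt p) L, hΩ,
    norm_coe_units_unrIntegers p Ωp, R1.isBDPLFunctionInt_map hL,
    R1.ideal_map_le_span_map_of_le p hdiv⟩

/-- **At a datum, two slots: `Σ`-data at `𝔮` ∧ the two-slot congruence frame ⟹ a ♭-frame AT `𝔭` with the divisibility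
for `XAc … 𝔮 ∅ γ`** — for `𝔭 := 𝔭_{ι'}`, `𝔮 := 𝔭bar` EXACTLY the datum-level conclusion of
`P2.IMCDivIntCoreFrameAtErratumDataB`. Unconditional in the two predicates; closes nothing by itself.
[cite: Castella2018Erratum, (2.4) and proof of Thm. 1.1 (p. 4)] -/
theorem P2.exists_intCoreFrame_of_roadFF_fitting_twoSlot [W.IsElliptic]
    (hSD : P2.RoadFF.SigmaDataAt W p κ 𝔮 γ S PS)
    (hF : P2.RoadFF.FittingCongruenceFrameTwoSlotAt W p κ 𝔭 𝔮 γ ι f S PS) :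
    ∃ (ΩK : ℂ) (Ωp : ℂ_[p]) (Q : PowerSeries 𝓞_ℂ_[p]), ΩK ≠ 0 ∧ ‖Ωp‖ = 1 ∧
      R1.IsBDPLFunctionInt p ι 𝔭 κ γ f ΩK Ωp Q ∧
      (XAc.charIdeal (W.baseChange K) p κ 𝔮 ∅ γ).map (PowerSeries.map (R1.toCpInt p)) ≤
        Ideal.span {Q} := by
  obtain ⟨ΩK, Ωp, L, hΩ, hL, hdiv⟩ := P2.exists_unrFrame_charIdeal_map_le_of_roadFF_fitting_twoSlot hSD hF
  exact P2.exists_intCoreFrame_of_unrFrame_of_charIdeal_map_le_twoSlot hΩ hL hdiv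

universe v w

/-- **Hida members with their OWN coefficient rings feed the two-slot congruence frame** (p490889's
`P2.RoadFF.fittingCongruenceFrameAt_of_members_descent_le_printed` with the frame at `𝔭` and the members comparing with
`X^Σ` STRICT AT `𝔮`): an `R₀`-frame at `𝔭` [Cas18 Thm. 3.1], `L^Σ` with `L·φ(P_Σ) ∣ L^Σ` [Cas18 (3.1)], `Σ` finite, and
for every `m ≥ 1` a coefficient square `Λ → R'_m →(φ'_m) S'_m ← R₀⟦T⟧` (`S'_m` faithfully flat over `R₀⟦T⟧`), a finite
`R'_m`-module `N_m` over a Noetherian UFD `R'_m`, an `R'_m`-isomorphism `(R'_m ⊗_Λ X^Σ_𝔮)/p^m ≅ N_m/p^m` [(b) + Lemma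
2.1], the PRINTED (2.5)_m "`N_m` torsion → `Ch_{R'_m}(N_m)·S'_m ⊆ (L_m)`" [FW21 Thm. 4.41, PREPRINT] and
`(L_m) ⊆ (L^Σ) + (p^m)` in `S'_m` [(c)] ⟹ the two-slot shape (coefficient descent
`AcSelmer.XAc.map_fittingIdeal_le_span_of_oneSided_congruences_descent_le_printed` at the slot `𝔮`). CONDITIONAL on the
displayed inputs. [cite: Castella2018Erratum, (2.5) and proof of Thm. 1.1 (p. 4), read one-sidedly]
[cite: FouquetWan2021, Thm. 4.41 (shape of the conclusion)] [cite: Skinner2016PacificMC, §3.1 (p. 192)] -/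
theorem P2.RoadFF.fittingCongruenceFrameTwoSlotAt_of_members_descent_le_printed [W.IsElliptic] {ΩK : ℂ}
    {Ωp : (unrIntegers p)ˣ} {L : UnrSeries p} (hΩ : ΩK ≠ 0)
    (hL : IsBDPLFunction ι 𝔭 κ γ f ΩK ((Ωp : unrIntegers p) : ℂ_[p]) L)
    (LS : UnrSeries p) (hLS : L * PowerSeries.map (toUnr p) PS ∣ LS) (hS : S.Finite)
    (R' : ℕ → Type v) [∀ m, CommRing (R' m)] [∀ m, IsNoetherianRing (R' m)] [∀ m, IsDomain (R' m)]
    [∀ m, UniqueFactorizationMonoid (R' m)] [∀ m, Algebra (IwasawaAlgebra p) (R' m)]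
    (S' : ℕ → Type w) [∀ m, CommRing (S' m)] [∀ m, Algebra (UnrSeries p) (S' m)]
    [∀ m, Module.FaithfullyFlat (UnrSeries p) (S' m)] (φ' : ∀ m, R' m →+* S' m)
    (hφ' : ∀ m, (φ' m).comp (algebraMap (IwasawaAlgebra p) (R' m)) =
      (algebraMap (UnrSeries p) (S' m)).comp (PowerSeries.map (toUnr p)))
    (Nm : ℕ → Type) [∀ m, AddCommGroup (Nm m)] [∀ m, Module (R' m) (Nm m)]
    [∀ m, Module.Finite (R' m) (Nm m)] (Lm : ∀ m, S' m)
    (e : ∀ m : ℕ, 1 ≤ m →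
      (((R' m ⊗[IwasawaAlgebra p] XAc (W.baseChange K) p κ 𝔮 S γ) ⧸
          (((Ideal.span {(PowerSeries.C (p : ℤ_[p]) : IwasawaAlgebra p)}).map
              (algebraMap (IwasawaAlgebra p) (R' m))) ^ m •
            (⊤ : Submodule (R' m) (R' m ⊗[IwasawaAlgebra p] XAc (W.baseChange K) p κ 𝔮 S γ))))
          ≃ₗ[R' m]
        (Nm m ⧸ (((Ideal.span {(PowerSeries.C (p : ℤ_[p]) : IwasawaAlgebra p)}).map
            (algebraMap (IwasawaAlgebra p) (R' m))) ^ m • (⊤ : Submodule (R' m) (Nm m))))))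
    (hCh : ∀ m : ℕ, 1 ≤ m → Module.IsTorsion (R' m) (Nm m) →
      (Module.charIdeal (R' m) (Nm m)).map (φ' m) ≤ Ideal.span {Lm m})
    (hc : ∀ m : ℕ, 1 ≤ m →
      Ideal.span {Lm m} ≤
        Ideal.span {algebraMap (UnrSeries p) (S' m) LS} ⊔
          (((Ideal.span {(PowerSeries.C (p : ℤ_[p]) : IwasawaAlgebra p)}).map
              (PowerSeries.map (toUnr p))).map (algebraMap (UnrSeries p) (S' m))) ^ m) :
    P2.RoadFF.FittingCongruenceFrameTwoSlotAt W p κ 𝔭 𝔮 γ ι f S PS :=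
  ⟨ΩK, Ωp, L, LS, hΩ, hL, hLS,
    AcSelmer.XAc.map_fittingIdeal_le_span_of_oneSided_congruences_descent_le_printed (W.baseChange K) p κ
      𝔮 γ hS LS R' S' φ' hφ' Nm Lm e hCh hc⟩

end TwoSlot

/-! ### §2 On the tree: the two predicates at every erratum datum, X-slot at `𝔭bar` ⟹ the repaired crux's shape -/

section OnTree

variable (W : WeierstrassCurve ℚ) [W.IsElliptic] [W.IsGloballyMinimal] (p : ℕ) [Fact p.Prime]
  (Sg : ∀ (K : Type) [Field K] [NumberField K], Set (HeightOneSpectrum (𝓞 K)))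
  (PSg : ∀ (K : Type) [Field K] [NumberField K], ZpExtension K p → Field.absoluteGaloisGroup K →
    IwasawaAlgebra p)

/-- **ROAD FF `Σ`-DATA AT EVERY ERRATUM DATUM AND EVERY X-SLOT `𝔭bar ≠ 𝔭_{ι'}`** for the choice functions `Sg = Σ(·)`,
`PSg = P_Σ(·)` (shape; asserts nothing) — the binders of `P2.IMCDivIntCoreFrameAtErratumDataB W p` VERBATIM, and at each
datum and slot `P2.RoadFF.SigmaDataAt W p κ 𝔭bar γ (Sg K) (PSg K κ γ)`. A predicate; NEVER a theorem in this cell (its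
content is F7 = JSW17 Prop. 3.3.2 + CTL, published; statement of the first v4 stub on the repaired item).
[claim: Castella2018Erratum, status: under-review]
[cite: Castella2018Erratum, Thm. 1.1 and its proof (pp. 1, 4) (shape only; nothing asserted)]
[cite: JetchevSkinnerWan2017, Prop. 3.3.2 (shape only; nothing asserted)] -/
@[conjecture]
def P2.RoadFF.SigmaDataAtErratumDataB : Prop :=
  ∀ [NeZero (W.conductorNorm ℤ)] (q : ℕ) [Fact q.Prime] (K : Type) [Field K] [NumberField K]
    (Dt : ModularParametrizationData W (W.conductorNorm ℤ))
    (H : HeegnerDatum (W.conductorNorm ℤ) (NumberField.discr K)) (w₀ : InfinitePlace K)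
    (P : (W.baseChange K).toAffine.Point), ErratumHypotheses W p → W.analyticRank = 1 →
    q ≠ p → Mult W q → ¬ W.HasSplitMultiplicativeReductionAtPrime q →
    ¬ p ∣ padicValInt q W.minimalDiscriminantInt → IsErratumField W K q →
    Cas20Standing K p (W.conductorNorm ℤ / p) →
    WeierstrassCurve.Affine.Point.map w₀.embedding.toRatAlgHom P = heegnerPointComplex Dt H →
    ¬ (p : ℤ) ∣ Dt.c → ¬ IsOfFinAddOrder P →
    ∀ (κ : ZpExtension K p), κ.IsAnticyclotomic →
      ∀ (γ : Field.absoluteGaloisGroup K) [Fact (κ.IsTopGenerator γ)] (ι' : PadicAlgCl p ≃+* ℂ)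
        (e : K →+* ℚ_[p]),
        (∀ k : 𝓞 K, k ∈ (primeOfEmbeddingDatum p ι' w₀.embedding).asIdeal ↔ ‖e (k : K)‖ < 1) →
        ∀ (𝔭bar : HeightOneSpectrum (𝓞 K)), ((p : ℕ) : 𝓞 K) ∈ 𝔭bar.asIdeal →
          𝔭bar ≠ primeOfEmbeddingDatum p ι' w₀.embedding →
          P2.RoadFF.SigmaDataAt W p κ 𝔭bar γ (Sg K) (PSg K κ γ)

/-- **ROAD FF TWO-SLOT CONGRUENCE FRAME AT EVERY ERRATUM DATUM AND EVERY X-SLOT `𝔭bar ≠ 𝔭_{ι'}`** for the choice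
functions `Σ`, `P_Σ` (shape; asserts nothing) — same binders, and at each datum and slot
`P2.RoadFF.FittingCongruenceFrameTwoSlotAt W p κ 𝔭_{ι'} 𝔭bar γ ι' Dt.f (Sg K) (PSg K κ γ)` (frame at the datum's prime,
member limit for `X^Σ` strict at `𝔭bar`). The DECIDING predicate of Road FF on the repaired item (members, FW21 4.41,
congruences, descent). A predicate; NEVER a theorem in this cell. [claim: Castella2018Erratum, status: under-review]
[cite: Castella2018Erratum, Thm. 1.1 and its proof (pp. 1, 4) (shape only; nothing asserted)]
[cite: FouquetWan2021, Thm. 4.41 (shape only; nothing asserted)] -/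
@[conjecture]
def P2.RoadFF.FittingCongruenceFrameAtErratumDataB : Prop :=
  ∀ [NeZero (W.conductorNorm ℤ)] (q : ℕ) [Fact q.Prime] (K : Type) [Field K] [NumberField K]
    (Dt : ModularParametrizationData W (W.conductorNorm ℤ))
    (H : HeegnerDatum (W.conductorNorm ℤ) (NumberField.discr K)) (w₀ : InfinitePlace K)
    (P : (W.baseChange K).toAffine.Point), ErratumHypotheses W p → W.analyticRank = 1 →
    q ≠ p → Mult W q → ¬ W.HasSplitMultiplicativeReductionAtPrime q →
    ¬ p ∣ padicValInt q W.minimalDiscriminantInt → IsErratumField W K q →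
    Cas20Standing K p (W.conductorNorm ℤ / p) →
    WeierstrassCurve.Affine.Point.map w₀.embedding.toRatAlgHom P = heegnerPointComplex Dt H →
    ¬ (p : ℤ) ∣ Dt.c → ¬ IsOfFinAddOrder P →
    ∀ (κ : ZpExtension K p), κ.IsAnticyclotomic →
      ∀ (γ : Field.absoluteGaloisGroup K) [Fact (κ.IsTopGenerator γ)] (ι' : PadicAlgCl p ≃+* ℂ)
        (e : K →+* ℚ_[p]),
        (∀ k : 𝓞 K, k ∈ (primeOfEmbeddingDatum p ι' w₀.embedding).asIdeal ↔ ‖e (k : K)‖ < 1) →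
        ∀ (𝔭bar : HeightOneSpectrum (𝓞 K)), ((p : ℕ) : 𝓞 K) ∈ 𝔭bar.asIdeal →
          𝔭bar ≠ primeOfEmbeddingDatum p ι' w₀.embedding →
          P2.RoadFF.FittingCongruenceFrameTwoSlotAt W p κ (primeOfEmbeddingDatum p ι' w₀.embedding) 𝔭bar γ
            ι' Dt.f (Sg K) (PSg K κ γ)

variable {W p Sg PSg}

/-- **THE GLUE, COEFFICIENT-FREE ROAD FF ON THE REPAIRED ITEM: `Σ`-data and the two-slot congruence frame at every
erratum datum and X-slot (for ANY choice functions `Sg`, `PSg`) ⟹ `P2.IMCDivIntCoreFrameAtErratumDataB W p`** — the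
composition the two-stub v4 skeleton on `IMCDivAtErratumDataAllR` uses:
`fun W _ _ p _ ↦ P2.imcDivIntCoreFrameAtErratumDataB_of_roadFF_fitting (s1 W p) (s2 W p)`. CONDITIONAL on the two
predicates; closes nothing by itself. [cite: Castella2018Erratum, proof of Thm. 1.1 (p. 4), read one-sidedly]
[cite: Skinner2016PacificMC, §3.1 (p. 192)] -/
theorem P2.imcDivIntCoreFrameAtErratumDataB_of_roadFF_fitting
    (hSD : P2.RoadFF.SigmaDataAtErratumDataB W p Sg PSg)
    (hF : P2.RoadFF.FittingCongruenceFrameAtErratumDataB W p Sg PSg) :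
    P2.IMCDivIntCoreFrameAtErratumDataB W p := by
  intro _ q _ K _ _ Dt H w₀ P hE hr hqp hmq hns hvq hK hCas hP hc hinf κ hκ γ _ ι' e he 𝔭bar h𝔭bar hne
  exact P2.exists_intCoreFrame_of_roadFF_fitting_twoSlot
    (hSD q K Dt H w₀ P hE hr hqp hmq hns hvq hK hCas hP hc hinf κ hκ γ ι' e he 𝔭bar h𝔭bar hne)
    (hF q K Dt H w₀ P hE hr hqp hmq hns hvq hK hCas hP hc hinf κ hκ γ ι' e he 𝔭bar h𝔭bar hne)

omit [W.IsElliptic] in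
/-- **The A-side `Σ`-data wrapper at EVERY slot feeds the B-side one**: if `Σ`-data holds at every erratum datum for
EVERY prime `𝔮 ∋ p` (the natural output of F7, which does not see the slot), it holds in particular at `𝔭bar`.
Bookkeeping. [folklore] -/
theorem P2.RoadFF.sigmaDataAtErratumDataB_of_forall_slot
    (h : ∀ [NeZero (W.conductorNorm ℤ)] (q : ℕ) [Fact q.Prime] (K : Type) [Field K] [NumberField K]
      (Dt : ModularParametrizationData W (W.conductorNorm ℤ))
      (H : HeegnerDatum (W.conductorNorm ℤ) (NumberField.discr K)) (w₀ : InfinitePlace K)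
      (P : (W.baseChange K).toAffine.Point), ErratumHypotheses W p → W.analyticRank = 1 →
      q ≠ p → Mult W q → ¬ W.HasSplitMultiplicativeReductionAtPrime q →
      ¬ p ∣ padicValInt q W.minimalDiscriminantInt → IsErratumField W K q →
      Cas20Standing K p (W.conductorNorm ℤ / p) →
      WeierstrassCurve.Affine.Point.map w₀.embedding.toRatAlgHom P = heegnerPointComplex Dt H →
      ¬ (p : ℤ) ∣ Dt.c → ¬ IsOfFinAddOrder P →
      ∀ (κ : ZpExtension K p), κ.IsAnticyclotomic →
        ∀ (γ : Field.absoluteGaloisGroup K) [Fact (κ.IsTopGenerator γ)]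
          (𝔮 : HeightOneSpectrum (𝓞 K)), ((p : ℕ) : 𝓞 K) ∈ 𝔮.asIdeal →
          P2.RoadFF.SigmaDataAt W p κ 𝔮 γ (Sg K) (PSg K κ γ)) :
    P2.RoadFF.SigmaDataAtErratumDataB W p Sg PSg := by
  intro _ q _ K _ _ Dt H w₀ P hE hr hqp hmq hns hvq hK hCas hP hc hinf κ hκ γ _ ι' e he 𝔭bar h𝔭bar _
  exact h q K Dt H w₀ P hE hr hqp hmq hns hvq hK hCas hP hc hinf κ hκ γ 𝔭bar h𝔭bar

end OnTree

end Summit.BirchSwinnertonDyer.Rank1Residual.X11b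

end
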